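import Mathlib
import Literature.Probability.Distributions.ComplexGaussianVectors
import Literature.Probability.Distributions.GaussianHelmert
import Literature.Probability.RandomMatrix.ComplexGaussianVector
import Literature.Barriers.CriticalPhenomena.RigorousRGSmallParameterProofs
import HarnessLib

/-!
# Gaussian Chernoff bound for quadratic forms

For a standard Gaussian vector `g` of `ℂ^N` (Mathlib's `stdGaussian` on the real inner product space
`EuclideanSpace ℂ (Fin N)`: real and imaginary parts of all coordinates i.i.d. `N(0,1)`), a positive
semidefinite Hermitian matrix `Q` and `b > 0`,

  `P( g* Q g ≤ b ‖g‖² ) ≤ 2^N / det(1 + Q/b)`     (`stdGaussian_measure_quadForm_le`).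

Proof: diagonalise `Q` (the event and the Gaussian are unitarily invariant), so that in the eigenbasis
the event reads `Σ μ_j |z_j|² ≤ b Σ |z_j|²` for independent standard complex Gaussians `z_j`; Chernoff
with `λ = 1/(4b)`: `P ≤ E exp(Σ (b − μ_j)|z_j|²/(4b)) = ∏ (1 − (1 − μ_j/b)/2)⁻¹ = ∏ 2/(1 + μ_j/b)`
(`integral_exp_mul_norm_sq_stdGaussian_complex`: `E e^{s|z|²} = (1 − 2s)⁻¹` for `s < 1/2`).  This is
the probabilistic input of the MULTISCALE (entrywise) rigidity bound for Haar unitaries (route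
`EguchiKawaiDirectionLadder`, crux `TripleSmallBallMargin`, stub plan A1).  All [folklore].
-/

noncomputable section

open MeasureTheory ProbabilityTheory Matrix WithLp Finset
open Literature.Probability.Distributions Literature.Probability.RandomMatrix
open scoped ENNReal ComplexOrder

namespace Summit.QuantumFields.YangMills.Theorems.EguchiKawaiDirectionLadder.HaarColumns

/-! ### The one-dimensional moment generating functions -/

/-- `∫ e^{s x²} dN(0,1) = (√(2π))⁻¹ √(π/(1/2 − s))` and this number squares to `(1 − 2s)⁻¹` when
`s < 1/2`. [folklore] -/
theorem integral_exp_mul_sq_gaussianReal_sq {s : ℝ} (hs : s < 1 / 2) :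
    (∫ x, Real.exp (s * x ^ 2) ∂(gaussianReal 0 1)) ^ 2 = (1 - 2 * s)⁻¹ := by
  rw [Literature.Barriers.CriticalPhenomena.HierarchicalRG.integral_exp_mul_sq_gaussianReal
    one_ne_zero s]
  have h1 : (0 : ℝ) < 1 / (2 * ((1 : NNReal) : ℝ)) - s := by rw [NNReal.coe_one]; linarith
  rw [mul_pow, inv_pow, Real.sq_sqrt (by positivity), Real.sq_sqrt (div_pos Real.pi_pos h1).le,
    NNReal.coe_one]
  field_simp

/-- The real Gaussian integral of `e^{s x²}` is positive for `s < 1/2`. [folklore] -/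
theorem integral_exp_mul_sq_gaussianReal_pos {s : ℝ} (hs : s < 1 / 2) :
    0 < ∫ x, Real.exp (s * x ^ 2) ∂(gaussianReal 0 1) := by
  rw [Literature.Barriers.CriticalPhenomena.HierarchicalRG.integral_exp_mul_sq_gaussianReal
    one_ne_zero s]
  have h1 : (0 : ℝ) < 1 / (2 * ((1 : NNReal) : ℝ)) - s := by rw [NNReal.coe_one]; linarith
  exact mul_pos (inv_pos.2 (Real.sqrt_pos.2 (by positivity))) (Real.sqrt_pos.2 (div_pos Real.pi_pos h1))

/-- `x ↦ e^{s x²}` is integrable for `N(0,1)` when `s < 1/2` (its integral is a positive number).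
[folklore] -/
theorem integrable_exp_mul_sq_gaussianReal {s : ℝ} (hs : s < 1 / 2) :
    Integrable (fun x : ℝ => Real.exp (s * x ^ 2)) (gaussianReal 0 1) := by
  by_contra h
  have := integral_exp_mul_sq_gaussianReal_pos hs
  rw [integral_undef h] at this
  exact lt_irrefl _ this

/-- **Complex standard Gaussian**: `∫ e^{s|z|²} dγ_ℂ(z) = (1 − 2s)⁻¹` for `s < 1/2` (`γ_ℂ` = Mathlib's
`stdGaussian ℂ`, real and imaginary parts i.i.d. `N(0,1)`), together with integrability. [folklore] -/
theorem integral_exp_mul_norm_sq_stdGaussian_complex {s : ℝ} (hs : s < 1 / 2) :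
    Integrable (fun z : ℂ => Real.exp (s * ‖z‖ ^ 2)) (stdGaussian ℂ) ∧
      ∫ z, Real.exp (s * ‖z‖ ^ 2) ∂(stdGaussian ℂ) = (1 - 2 * s)⁻¹ := by
  set bI := Complex.orthonormalBasisOneI with hbI
  have hrepr := stdGaussian_eq_map_pi_orthonormalBasis bI
  set T : (Fin 2 → ℝ) → ℂ := fun x => ∑ i, x i • bI i with hT
  have hTm : Measurable T := by fun_prop
  -- `‖T x‖² = Σ (x i)²`
  have hnorm : ∀ x : Fin 2 → ℝ, ‖T x‖ ^ 2 = ∑ i, (x i) ^ 2 := by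
    intro x
    rw [hT]
    dsimp only
    rw [bI.sum_repr_symm, LinearIsometryEquiv.norm_map, EuclideanSpace.real_norm_sq_eq]
  have hcomp : (fun z : ℂ => Real.exp (s * ‖z‖ ^ 2)) ∘ T =
      fun x : Fin 2 → ℝ => ∏ i, Real.exp (s * (x i) ^ 2) := by
    funext x
    rw [Function.comp_apply, hnorm, Finset.mul_sum, Real.exp_sum]
  have hint : Integrable (fun x : Fin 2 → ℝ => ∏ i, Real.exp (s * (x i) ^ 2))
      (Measure.pi fun _ : Fin 2 => gaussianReal 0 1) :=
    Integrable.fintype_prod (fun _ => integrable_exp_mul_sq_gaussianReal hs)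
  refine ⟨?_, ?_⟩
  · rw [hrepr]
    refine (integrable_map_measure (by fun_prop) hTm.aemeasurable).2 ?_
    rw [hcomp]; exact hint
  · rw [hrepr, integral_map hTm.aemeasurable (by fun_prop)]
    change ∫ x, ((fun z : ℂ => Real.exp (s * ‖z‖ ^ 2)) ∘ T) x ∂_ = _
    rw [hcomp]
    calc ∫ x : Fin 2 → ℝ, ∏ i, Real.exp (s * x i ^ 2) ∂(Measure.pi fun _ : Fin 2 => gaussianReal 0 1)
        = (∫ y, Real.exp (s * y ^ 2) ∂(gaussianReal 0 1)) ^ Fintype.card (Fin 2) :=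
          integral_fintype_prod_eq_pow (fun y : ℝ => Real.exp (s * y ^ 2))
      _ = (1 - 2 * s)⁻¹ := by rw [Fintype.card_fin, integral_exp_mul_sq_gaussianReal_sq hs]

/-! ### Chernoff in coordinates -/

/-- **Chernoff bound in coordinates**: for independent standard complex Gaussians `z_j`, weights
`μ_j ≥ 0` and `b > 0`, `P(Σ μ_j |z_j|² ≤ b Σ |z_j|²) ≤ ∏ 2/(1 + μ_j/b)`. [folklore] -/
theorem pi_stdGaussian_measure_weighted_le {N : ℕ} (μ : Fin N → ℝ) (hμ : ∀ j, 0 ≤ μ j) {b : ℝ}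
    (hb : 0 < b) :
    (Measure.pi fun _ : Fin N => stdGaussian ℂ)
        {z : Fin N → ℂ | ∑ j, μ j * ‖z j‖ ^ 2 ≤ b * ∑ j, ‖z j‖ ^ 2} ≤
      ENNReal.ofReal (∏ j, 2 / (1 + μ j / b)) := by
  set P := Measure.pi fun _ : Fin N => stdGaussian ℂ with hP
  set sj : Fin N → ℝ := fun j => (b - μ j) / (4 * b) with hsj
  have hsj_lt : ∀ j, sj j < 1 / 2 := by
    intro j
    rw [hsj]
    dsimp only
    rw [div_lt_iff₀ (by positivity)]
    nlinarith [hμ j]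
  set F : (Fin N → ℂ) → ℝ := fun z => ∏ j, Real.exp (sj j * ‖z j‖ ^ 2) with hF
  have hFint : Integrable F P :=
    Integrable.fintype_prod (fun j => (integral_exp_mul_norm_sq_stdGaussian_complex (hsj_lt j)).1)
  have hFval : ∫ z, F z ∂P = ∏ j, 2 / (1 + μ j / b) := by
    rw [hF, hP]
    calc ∫ z : Fin N → ℂ, ∏ j, Real.exp (sj j * ‖z j‖ ^ 2) ∂(Measure.pi fun _ : Fin N => stdGaussian ℂ)
        = ∏ j, ∫ z, Real.exp (sj j * ‖z‖ ^ 2) ∂(stdGaussian ℂ) :=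
          integral_fintype_prod_eq_prod (fun (j : Fin N) (z : ℂ) => Real.exp (sj j * ‖z‖ ^ 2))
      _ = ∏ j, 2 / (1 + μ j / b) := ?_
    refine Finset.prod_congr rfl fun j _ => ?_
    rw [(integral_exp_mul_norm_sq_stdGaussian_complex (hsj_lt j)).2, hsj]
    have hbμ : 0 < b + μ j := by linarith [hμ j]
    have h1 : 1 - 2 * ((b - μ j) / (4 * b)) = (b + μ j) / (2 * b) := by field_simp; ring
    have h2 : 2 / (1 + μ j / b) = (2 * b) / (b + μ j) := by
      field_simp
    dsimp only
    rw [h1, h2, inv_div]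
  -- `1_E ≤ F` on the event
  have hind : ∀ z, z ∈ {z : Fin N → ℂ | ∑ j, μ j * ‖z j‖ ^ 2 ≤ b * ∑ j, ‖z j‖ ^ 2} → 1 ≤ F z := by
    intro z hz
    rw [Set.mem_setOf_eq] at hz
    rw [hF]
    dsimp only
    rw [← Real.exp_sum]
    refine Real.one_le_exp ?_
    have : ∑ j, sj j * ‖z j‖ ^ 2 = (b * ∑ j, ‖z j‖ ^ 2 - ∑ j, μ j * ‖z j‖ ^ 2) / (4 * b) := by
      rw [hsj, Finset.mul_sum, ← Finset.sum_sub_distrib, Finset.sum_div]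
      refine Finset.sum_congr rfl fun j _ => ?_
      ring
    rw [this]
    exact div_nonneg (by linarith) (by positivity)
  have hFnn : ∀ z, 0 ≤ F z := fun z => Finset.prod_nonneg fun j _ => (Real.exp_pos _).le
  calc P {z : Fin N → ℂ | ∑ j, μ j * ‖z j‖ ^ 2 ≤ b * ∑ j, ‖z j‖ ^ 2}
      = ∫⁻ z in {z : Fin N → ℂ | ∑ j, μ j * ‖z j‖ ^ 2 ≤ b * ∑ j, ‖z j‖ ^ 2}, 1 ∂P := by
        rw [setLIntegral_one]
    _ ≤ ∫⁻ z in {z : Fin N → ℂ | ∑ j, μ j * ‖z j‖ ^ 2 ≤ b * ∑ j, ‖z j‖ ^ 2},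
          ENNReal.ofReal (F z) ∂P := by
        refine setLIntegral_mono' ?_ fun z hz => ?_
        · exact measurableSet_le (by fun_prop) (by fun_prop)
        · rw [← ENNReal.ofReal_one]; exact ENNReal.ofReal_le_ofReal (hind z hz)
    _ ≤ ∫⁻ z, ENNReal.ofReal (F z) ∂P := setLIntegral_le_lintegral _ _
    _ = ENNReal.ofReal (∫ z, F z ∂P) :=
        (ofReal_integral_eq_lintegral_ofReal hFint (Filter.Eventually.of_forall hFnn)).symm
    _ = ENNReal.ofReal (∏ j, 2 / (1 + μ j / b)) := by rw [hFval]

/-! ### The bound for a quadratic form on `ℂ^N` -/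

/-- In the eigenbasis: for a Hermitian `Q` with eigenvector unitary `U` and eigenvalues `μ`,
`g* Q g = Σ μ_j |(U* g)_j|²`. [folklore] -/
theorem star_dotProduct_mulVec_eq_sum_eigenvalues {N : ℕ} {Q : Matrix (Fin N) (Fin N) ℂ}
    (hQ : Q.IsHermitian) (g : Fin N → ℂ) :
    star g ⬝ᵥ Q *ᵥ g =
      ((∑ j, hQ.eigenvalues j *
        ‖((hQ.eigenvectorUnitary : Matrix (Fin N) (Fin N) ℂ)ᴴ *ᵥ g) j‖ ^ 2 : ℝ) : ℂ) := by
  set U : Matrix (Fin N) (Fin N) ℂ := (hQ.eigenvectorUnitary : Matrix (Fin N) (Fin N) ℂ) with hU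
  have hUU : U * Uᴴ = 1 := by
    rw [hU, ← Matrix.star_eq_conjTranspose]; exact Unitary.coe_mul_star_self hQ.eigenvectorUnitary
  have hdiag : Uᴴ * Q * U = diagonal (RCLike.ofReal ∘ hQ.eigenvalues) := by
    have := hQ.conjStarAlgAut_star_eigenvectorUnitary
    rw [Unitary.conjStarAlgAut_star_apply] at this
    exact this
  set c : Fin N → ℂ := Uᴴ *ᵥ g with hc
  -- `g = U c`
  have hg : U *ᵥ c = g := by
    rw [hc, mulVec_mulVec, hUU, one_mulVec]
  have h1 : star g ⬝ᵥ Q *ᵥ g = star c ⬝ᵥ (Uᴴ * Q * U) *ᵥ c := by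
    calc star g ⬝ᵥ Q *ᵥ g = star (U *ᵥ c) ⬝ᵥ Q *ᵥ (U *ᵥ c) := by rw [hg]
      _ = (star c ᵥ* Uᴴ) ⬝ᵥ Q *ᵥ (U *ᵥ c) := by rw [star_mulVec]
      _ = star c ⬝ᵥ (Uᴴ *ᵥ (Q *ᵥ (U *ᵥ c))) := by rw [← dotProduct_mulVec]
      _ = star c ⬝ᵥ (Uᴴ * Q * U) *ᵥ c := by rw [mulVec_mulVec, mulVec_mulVec, Matrix.mul_assoc]
  rw [h1, hdiag, dotProduct, Complex.ofReal_sum]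
  refine Finset.sum_congr rfl fun j _ => ?_
  rw [mulVec_diagonal, Pi.star_apply, Function.comp_apply,
    show (RCLike.ofReal (hQ.eigenvalues j) : ℂ) = (hQ.eigenvalues j : ℂ) from rfl, Complex.star_def]
  push_cast
  rw [← Complex.conj_mul']
  ring

/-- The determinant of `1 + Q/b` for a Hermitian `Q` is `∏ (1 + μ_j/b)`. [folklore] -/
theorem det_one_add_smul_eq_prod_eigenvalues {N : ℕ} {Q : Matrix (Fin N) (Fin N) ℂ}
    (hQ : Q.IsHermitian) (b : ℝ) :
    (1 + (b⁻¹ : ℂ) • Q).det = ∏ j, ((1 + hQ.eigenvalues j / b : ℝ) : ℂ) := by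
  set U : Matrix (Fin N) (Fin N) ℂ := (hQ.eigenvectorUnitary : Matrix (Fin N) (Fin N) ℂ) with hU
  have hUU' : U * star U = 1 := by
    rw [hU]; exact Unitary.coe_mul_star_self hQ.eigenvectorUnitary
  set D : Matrix (Fin N) (Fin N) ℂ := diagonal (RCLike.ofReal ∘ hQ.eigenvalues) with hD
  have hspec : Q = U * D * star U := by
    have := hQ.spectral_theorem
    rw [Unitary.conjStarAlgAut_apply] at this
    exact this
  set D' : Matrix (Fin N) (Fin N) ℂ := diagonal (fun j => ((1 + hQ.eigenvalues j / b : ℝ) : ℂ)) with hD'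
  have hDD' : 1 + (b⁻¹ : ℂ) • D = D' := by
    rw [hD, hD', ← diagonal_smul, ← diagonal_one, diagonal_add]
    congr 1
    funext j
    simp only [Function.comp_apply, Pi.smul_apply, smul_eq_mul]
    push_cast
    rw [show (RCLike.ofReal (hQ.eigenvalues j) : ℂ) = (hQ.eigenvalues j : ℂ) from rfl]
    ring
  have h1 : 1 + (b⁻¹ : ℂ) • Q = U * D' * star U := by
    calc 1 + (b⁻¹ : ℂ) • Q = 1 + (b⁻¹ : ℂ) • (U * D * star U) := by rw [← hspec]
      _ = U * (1 + (b⁻¹ : ℂ) • D) * star U := by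
          rw [Matrix.mul_add, Matrix.add_mul, Matrix.mul_one, hUU', Matrix.mul_smul, Matrix.smul_mul]
      _ = U * D' * star U := by rw [hDD']
  have hdet1 : (U * D' * star U).det = D'.det := by
    rw [Matrix.det_mul, Matrix.det_mul, mul_comm U.det, mul_assoc, ← Matrix.det_mul, hUU',
      Matrix.det_one, mul_one]
  rw [h1, hdet1, hD', det_diagonal]

/-- **Gaussian Chernoff bound for a quadratic form.** For a positive semidefinite Hermitian `Q` on
`ℂ^N` and `b > 0`, the standard Gaussian measure of `{g : g* Q g ≤ b ‖g‖²}` is at most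
`2^N / det(1 + Q/b)`. [folklore] -/
theorem stdGaussian_measure_quadForm_le {N : ℕ} {Q : Matrix (Fin N) (Fin N) ℂ} (hQ : Q.PosSemidef)
    {b : ℝ} (hb : 0 < b) :
    stdGaussian (EuclideanSpace ℂ (Fin N))
        {g | (star (ofLp g) ⬝ᵥ Q *ᵥ ofLp g).re ≤ b * ‖g‖ ^ 2} ≤
      ENNReal.ofReal ((2 : ℝ) ^ N / (1 + (b⁻¹ : ℂ) • Q).det.re) := by
  have hH : Q.IsHermitian := hQ.1
  set μ : Fin N → ℝ := hH.eigenvalues with hμ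
  have hμ0 : ∀ j, 0 ≤ μ j := fun j => hQ.eigenvalues_nonneg j
  set Uu := hH.eigenvectorUnitary with hUu
  set U : Matrix (Fin N) (Fin N) ℂ := (Uu : Matrix (Fin N) (Fin N) ℂ) with hU
  -- the change of variables `c = U* g`
  set ψ := unitaryEuclidean (star Uu) with hψ
  have hψapp : ∀ g : EuclideanSpace ℂ (Fin N), ofLp (ψ g) = Uᴴ *ᵥ ofLp g := by
    intro g; rw [hψ, unitaryEuclidean_apply]; rfl
  set E₁ : Set (EuclideanSpace ℂ (Fin N)) :=
    {c | ∑ j, μ j * ‖c j‖ ^ 2 ≤ b * ∑ j, ‖c j‖ ^ 2} with hE₁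
  have hE₁m : MeasurableSet E₁ := measurableSet_le (by fun_prop) (by fun_prop)
  have hpre : {g : EuclideanSpace ℂ (Fin N) | (star (ofLp g) ⬝ᵥ Q *ᵥ ofLp g).re ≤ b * ‖g‖ ^ 2} =
      ψ ⁻¹' E₁ := by
    ext g
    simp only [Set.mem_setOf_eq, Set.mem_preimage, hE₁]
    rw [star_dotProduct_mulVec_eq_sum_eigenvalues hH (ofLp g), Complex.ofReal_re,
      ← LinearIsometryEquiv.norm_map ψ g, EuclideanSpace.norm_sq_eq, hψapp g]
  have hlaw : (stdGaussian (EuclideanSpace ℂ (Fin N))).map ψ = stdGaussian (EuclideanSpace ℂ (Fin N)) :=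
    stdGaussian_map_complexLinearIsometryEquiv ψ
  -- push to coordinates
  set E₂ : Set (Fin N → ℂ) := {z | ∑ j, μ j * ‖z j‖ ^ 2 ≤ b * ∑ j, ‖z j‖ ^ 2} with hE₂
  have hE₂m : MeasurableSet E₂ := measurableSet_le (by fun_prop) (by fun_prop)
  have hE₁₂ : E₁ = (ofLp : EuclideanSpace ℂ (Fin N) → Fin N → ℂ) ⁻¹' E₂ := by
    ext c; simp [hE₁, hE₂]
  have hpi : (stdGaussian (EuclideanSpace ℂ (Fin N))).map ofLp = Measure.pi fun _ : Fin N => stdGaussian ℂ :=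
    stdGaussian_piLp_map_ofLp
  -- the determinant
  have hdet : (1 + (b⁻¹ : ℂ) • Q).det.re = ∏ j, (1 + μ j / b) := by
    rw [det_one_add_smul_eq_prod_eigenvalues hH b, ← Complex.ofReal_prod, Complex.ofReal_re]
  have hprod : ∏ j, 2 / (1 + μ j / b) = (2 : ℝ) ^ N / ∏ j, (1 + μ j / b) := by
    rw [Finset.prod_div_distrib, Finset.prod_const, Finset.card_univ, Fintype.card_fin]
  calc stdGaussian (EuclideanSpace ℂ (Fin N))
        {g | (star (ofLp g) ⬝ᵥ Q *ᵥ ofLp g).re ≤ b * ‖g‖ ^ 2}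
      = stdGaussian (EuclideanSpace ℂ (Fin N)) (ψ ⁻¹' E₁) := by rw [hpre]
    _ = (stdGaussian (EuclideanSpace ℂ (Fin N))).map ψ E₁ :=
        (Measure.map_apply ψ.continuous.measurable hE₁m).symm
    _ = stdGaussian (EuclideanSpace ℂ (Fin N)) E₁ := by rw [hlaw]
    _ = (stdGaussian (EuclideanSpace ℂ (Fin N))).map ofLp E₂ := by
        rw [hE₁₂, Measure.map_apply (WithLp.measurable_ofLp 2 _) hE₂m]
    _ = (Measure.pi fun _ : Fin N => stdGaussian ℂ) E₂ := by rw [hpi]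
    _ ≤ ENNReal.ofReal (∏ j, 2 / (1 + μ j / b)) := pi_stdGaussian_measure_weighted_le μ hμ0 hb
    _ = ENNReal.ofReal ((2 : ℝ) ^ N / (1 + (b⁻¹ : ℂ) • Q).det.re) := by rw [hprod, hdet]

end Summit.QuantumFields.YangMills.Theorems.EguchiKawaiDirectionLadder.HaarColumns

end
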